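import Summits.QuantumFields.YangMills.Theorems.BalabanUVNodesN07SplitClauseOfShearVariation
import Summits.QuantumFields.YangMills.Theorems.AlphaInputsT3ACv3BlendLetters
import HarnessLib

/-!
# N07 [B11] (= [15] = [Balaban1985Variational]) Sect. F, road of record R0′, WIDTH-209 row (r2), FILE 12: **THE FINE DOOR's VARIATION LETTER `hvarU` ON A FINE LABEL BOX
# FROM PER-RUN SUMS** — the corner staircase → `d` straight runs, FILE 9 §1's per-bond socket on each run, the Landau per-bond letter `θ`, the per-run axial summand `Φ`
# DISPLAYED (the data lane's `N07FinePathCrossingCount.sum_dist1_fine_path_le` ∕ `…DataDownTheRadialTower` shape), chained through the corner for every PAIR of box sites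

Cell `pub-ymgap`, width seat `pub-ymgap-dag-n07-w8` g5, WIDTH-209 N07 row (r2) of road R0′, CLAIM-12 ∕ INTENT-12 (cell bus I.37800; own lineage FILE 9 p630500 ✓ → FILE 12;
dag-n07-w6 g0″ I.37487 «the staircase → runs decomposition and the U₁ (152) letter stay on your side»).  `--kind proof --supports stmt-QuantumFields-27364 --as helper` (K1⁹ per
dag-lead KEY MAP v2 ∕ GATE v1.69); count-neutral; def-free; generic torus `P`, gauge group `G`.
[15] = [Balaban1985Variational]; [I.4] = [Balaban1984PropagatorsI] (1.6)–(1.7) p. 18; [3] = [Balaban1985Averaging] (8), (11) p. 19; [6] = [Balaban1985RegularSpaces] Thm 2, Lemma 1.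

THE POINT.  FILE 9's ∕ FILE 11's FINE doors (`…_recordShearFineVariation_dominated_adm22_T4` ∕ `…_cubeDomains_box`) consume ONE letter on the shear side: the variation of the
gauge `u♮` over a fine site set `S`, `hvarU : ∀ x x′ ∈ S, dist1 (u♮(x)⁻¹·u♮(x′)) ≤ ς`.  With `S :=` a fine label box `castSite '' [LO, HI]` the letter comes from (i) the corner
staircase from `castSite LO` to any `castSite t`, `LO ≤ t ≤ HI` — `d` straight runs in coordinate order, each inside the box —; (ii) on each run FILE 9 §1 `dist1_fine_path_le_sum`:
`dist1 (u(x)·u(x + m·e_μ)⁻¹) ≤ Σ_{s<m} (dist1 U₁^u(b_s) + dist1 U₁(b_s))`; (iii) the axial side `Σ_{s<m} dist1 U₁^u(b_s) ≤ Φ_μ(m)` DISPLAYED per run — at the record this is the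
data lane's sum «per-fine-bond letter by the coarsest crossed face × crossing count» (dag-n07-w6 `N07FinePathCrossingCount.sum_dist1_fine_path_le`, `Φ_μ(m) = m·θ₀ + Σ_i (m∕L^{i+1} + 1)·θ_{i+1}`,
and its radial-tower edition) —; (iv) the Landau side `dist1 U₁(b) ≤ θ` per box bond (S3's unweighted (152) letter: `‖e^{iηA} − 1‖ ≲ ηt`, `η·L^{K−n} = 1`; DISPLAYED);
(v) chaining the runs (`PerturbedPlaquette.dist1_inv_mul_chain`) and, for a PAIR of box sites, passing through the corner (`×2`, `dist1_inv`).  Result: `hvarU` with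
`ς := 2·Σ_κ (Φ_κ(D_κ) + D_κ·θ)`, `D_κ := (HI_κ − LO_κ).toNat` — uniform in the height once `Φ`, `θ` are (the lineage's (166♭) factor; orders of magnitude are print's, NOT typed here).

WHAT IS PROVED (sorry-free; no definition; axioms standard).
* §1 `runSite_castSite` (`runSite (castSite z) μ m = castSite (update z μ (z_μ + m))`) · `update_mem_Icc` (a run from a box point towards `t ≤ HI` stays in `[LO, HI]`).
* §2 ★★ `dist1_inv_mul_runSite_le_of_runSum` — ONE run: `dist1 (u(x)⁻¹·u(x + m·e_μ)) ≤ Φm + m·θ` from the displayed run sum `Σ_{s<m} dist1 U₁^u(runBond x μ s) ≤ Φm` and the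
  per-bond Landau letter on the run.
* §3 ★★★ `dist1_corner_le_of_runSums` — the corner staircase: for `LO ≤ t ≤ HI`, `dist1 (u(castSite LO)⁻¹·u(castSite t)) ≤ Σ_κ (Φ_κ((t_κ − LO_κ).toNat) + (t_κ − LO_κ).toNat·θ)`,
  hypotheses `hrun` (every run inside the integer box: `LO ≤ z`, `update z μ (z_μ + m) ≤ HI` ⇒ `Σ_{s<m} dist1 U₁^u(runBond (castSite z) μ s) ≤ Φ_μ(m)`) and `hU₁` (box bonds).
* §4 ★★★ `fineVariation_le_of_runSums` — PAIRS: `Φ_κ` monotone, `0 ≤ θ` ⇒ `∀ x x′ ∈ castSite '' [LO, HI], dist1 (u(x)⁻¹·u(x′)) ≤ 2·Σ_κ (Φ_κ(D_κ) + D_κ·θ)` = the `hvarU` of the fine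
  doors with `S :=` the fine box · A6 `fineVariation_le_of_runSums_one` (at `u = 1`, `U₁ = 1` the hypotheses hold with `Φ = 0`, `θ = 0`).
HONEST SCOPE.  Count-neutral lattice ∕ group-algebra bookkeeping; `Φ`, `θ`, the gauge `u` (= `u♮`), `U₁` are HYPOTHESES ∕ binders; the val-anchoring of the data lane's count
(`hwrap`) is the instantiation's business (a box not passing the val-origin: `val = label`); nothing of [15]∕[6]∕[3]∕[I.4] ANALYSIS asserted; `LocalLettersSplitTopStepCore(G∕R)` ∕
`DatumGaugeSplitTopStepCore(G∕R)` ∕ `HalvingStepTop(Core)` ∕ `stub_prop8StepCoP13` NOT discharged; K0⁷ ∕ K1⁹ NOT closed; N07 NOT discharged; counts unmoved (typed 28∕28 · discharged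
5∕27); one finite 𝕋⁴ programme at fixed ε — the route closes the conditional finite-𝕋⁴ rung `BalabanLadder.UV` ONLY; the YM mass gap (Clay) is NOT proved by any of this; nothing
continuum ∕ ℝ⁴ ∕ OS.  No `sorry`, no `def`, no `instance`, no `notation`.

RELATED IN THE TREE, NOT DUPLICATED (stem check 2026-08-28T12:30Z: `ls …/Theorems | rg -i 'FineBoxShear|BoxShearVariation'` = ∅): dag-n07-w6 `N07FinePathCrossingCount` (the per-run
axial sum — the `Φ` of this file, CONSUMED in hypothesis form, not restated), `N07ShearSizeTopBox.box_reach` (staircases at level `j` with CONSTANT letters — a different output),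
FILE 9 §1 (the per-bond socket — CONSUMED), ym3-torus `PerturbedPlaquette.dist1_inv_mul_chain` (chaining — imported).
-/

set_option autoImplicit false

noncomputable section
open scoped BigOperators

namespace Summit.QuantumFields.YangMills.BalabanUVNodes.N07FineBoxShearVariation

open Literature.MathematicalPhysics.QuantumFieldTheory.Balaban1983to89
open LatticeFieldCalculus (runSite runBond runSite_succ runSite_zero)
open T4AxialGaugeSmallField (castSite)
open GaugeField (gaugeAct)
open B11GaugeGlue (dist1_inv_mul_eq)
open Summit.QuantumFields.YangMills.BalabanUVNodes.N07SplitClauseOfShearVariation (dist1_fine_path_le_sum)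
open Summit.QuantumFields.YangMills.Theorems.PerturbedPlaquette (dist1_inv_mul_chain)

/-! ## §1  Straight runs from projected integer points -/

section Runs

variable {P : Params}

/-- `x + m·e_μ` for `x = castSite z`: the projection of `z` with its `μ`-label raised by `m` (`runSite` is `update x μ (x_μ + m)`). [cite: Balaban1984PropagatorsI, (1.7) p.18 (bookkeeping)] -/
theorem runSite_castSite (z : Fin P.d → ℤ) (μ : Fin P.d) (m : ℕ) :
    runSite (castSite z : Site P 0) μ m = castSite (Function.update z μ (z μ + m)) := by
  funext κ
  by_cases h : κ = μ
  · subst h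
    simp [LatticeFieldCalculus.runSite, T4AxialGaugeSmallField.castSite_apply, Function.update_self]
  · simp [LatticeFieldCalculus.runSite, T4AxialGaugeSmallField.castSite_apply, Function.update_of_ne h]

/-- A run from a box point towards `t_μ ≤ HI_μ` stays in the box: `LO ≤ z ≤ HI`, `z_μ + m ≤ HI_μ` ⇒ `LO ≤ update z μ (z_μ + s) ≤ HI` for `s ≤ m`.
[cite: Balaban1985Variational, (144) p.300 (bookkeeping)] -/
theorem update_mem_Icc {LO HI z : Fin P.d → ℤ} (hlo : LO ≤ z) (hhi : z ≤ HI) {μ : Fin P.d} {m : ℕ} (hm : z μ + m ≤ HI μ) {s : ℕ} (hs : s ≤ m) :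
    LO ≤ Function.update z μ (z μ + s) ∧ Function.update z μ (z μ + s) ≤ HI := by
  refine ⟨fun κ => ?_, fun κ => ?_⟩
  · have h1 : LO κ ≤ z κ := hlo κ
    rw [Function.update_apply]
    split_ifs with h
    · subst h
      have h0 : (0 : ℤ) ≤ (s : ℤ) := Int.natCast_nonneg s
      linarith
    · exact h1
  · have h1 : z κ ≤ HI κ := hhi κ
    rw [Function.update_apply]
    split_ifs with h
    · subst h
      have h0 : (s : ℤ) ≤ (m : ℤ) := by exact_mod_cast hs
      linarith
    · exact h1

end Runs

/-! ## §2  One run: the per-bond socket with a displayed run sum and the Landau per-bond letter -/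

section OneRun

variable {P : Params} {G : Type*} [GaugeGroup G]

/-- ★★ **ONE STRAIGHT RUN**: for every gauge function `u` of `T_η` and every `U₁`, if along the run `x, x + e_μ, …, x + m·e_μ` the axial side sums to `Σ_{s<m} dist1 U₁^u(b_s) ≤ Φm`
(`b_s = runBond x μ s`; DISPLAYED — the data lane's per-run sum) and the Landau side is `dist1 U₁(b_s) ≤ θ` per bond, then `dist1 (u(x)⁻¹·u(x + m·e_μ)) ≤ Φm + m·θ`
(FILE 9 §1 `dist1_fine_path_le_sum`). [cite: Balaban1985Averaging, (8) p.19; Balaban1984PropagatorsI, (1.7) p.18; Balaban1985Variational, (152) p.301, (154) p.302] -/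
theorem dist1_inv_mul_runSite_le_of_runSum (u : GaugeTransf P 0 G) (U₁ : GaugeField P 0 G) (x : Site P 0) (μ : Fin P.d) (m : ℕ) {Φm θ : ℝ}
    (hrun : ∑ s ∈ Finset.range m, dist1 (gaugeAct u U₁ (runBond x μ s)) ≤ Φm) (hU₁ : ∀ s, s < m → dist1 (U₁ (runBond x μ s)) ≤ θ) :
    dist1 ((u x)⁻¹ * u (runSite x μ m)) ≤ Φm + m * θ := by
  have hpath := dist1_fine_path_le_sum u U₁ (fun s => runSite x μ s) (fun s => runBond x μ s) m
    (fun s _ => Or.inl ⟨rfl, by rw [runSite_succ]; rfl⟩)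
  rw [runSite_zero] at hpath
  rw [dist1_inv_mul_eq]
  refine hpath.trans ?_
  rw [Finset.sum_add_distrib]
  refine add_le_add hrun ?_
  calc ∑ s ∈ Finset.range m, dist1 (U₁ (runBond x μ s)) ≤ ∑ _s ∈ Finset.range m, θ :=
        Finset.sum_le_sum fun s hs => hU₁ s (Finset.mem_range.mp hs)
    _ = m * θ := by rw [Finset.sum_const, Finset.card_range, nsmul_eq_mul]

end OneRun

/-! ## §3  The corner staircase: `d` runs in coordinate order, chained -/

section Staircase

variable {P : Params} {G : Type*} [GaugeGroup G]

/-- ★★★ **THE CORNER STAIRCASE.**  Fine label box `[LO, HI]`; per-run axial sums DISPLAYED for every run inside the integer box (`hrun`: `LO ≤ z` and `update z μ (z_μ + m) ≤ HI` ⇒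
`Σ_{s<m} dist1 U₁^u(runBond (castSite z) μ s) ≤ Φ_μ(m)`); Landau per-bond letter `θ` on the bonds with both ends in `castSite '' [LO, HI]` (`hU₁`).  Then for every `t` with
`LO ≤ t ≤ HI`: `dist1 (u(castSite LO)⁻¹·u(castSite t)) ≤ Σ_κ (Φ_κ((t_κ − LO_κ).toNat) + (t_κ − LO_κ).toNat·θ)` — walk the coordinates in order, §2 on each leg, chain with
`dist1 (a⁻¹c) ≤ dist1 (a⁻¹b) + dist1 (b⁻¹c)`. [cite: Balaban1984PropagatorsI, (1.7) p.18; Balaban1985Variational, (144) p.300, (152) p.301; Balaban1985Averaging, (8) p.19] -/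
theorem dist1_corner_le_of_runSums (u : GaugeTransf P 0 G) (U₁ : GaugeField P 0 G) {LO HI : Fin P.d → ℤ} (Φ : Fin P.d → ℕ → ℝ) {θ : ℝ}
    (hrun : ∀ (z : Fin P.d → ℤ) (μ : Fin P.d) (m : ℕ), LO ≤ z → Function.update z μ (z μ + m) ≤ HI →
      ∑ s ∈ Finset.range m, dist1 (gaugeAct u U₁ (runBond (castSite z : Site P 0) μ s)) ≤ Φ μ m)
    (hU₁ : ∀ b : PBond P 0, b.src ∈ (castSite '' Set.Icc LO HI : Set (Site P 0)) → b.tgt ∈ (castSite '' Set.Icc LO HI : Set (Site P 0)) → dist1 (U₁ b) ≤ θ)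
    {t : Fin P.d → ℤ} (hlo : LO ≤ t) (hhi : t ≤ HI) :
    dist1 ((u (castSite LO : Site P 0))⁻¹ * u (castSite t)) ≤ ∑ κ, (Φ κ (t κ - LO κ).toNat + ((t κ - LO κ).toNat : ℝ) * θ) := by
  classical
  -- the partial corners `p i`: the first `i` coordinates already moved to `t`, the others still at `LO`
  set p : ℕ → (Fin P.d → ℤ) := fun i κ => if (κ : ℕ) < i then t κ else LO κ with hp
  set g : Fin P.d → ℝ := fun κ => Φ κ (t κ - LO κ).toNat + ((t κ - LO κ).toNat : ℝ) * θ with hgdef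
  have hp0 : p 0 = LO := by funext κ; simp [hp]
  have hpd : p P.d = t := by funext κ; simp [hp, κ.isLt]
  have hpLO : ∀ i, LO ≤ p i := by
    intro i κ
    have h1 : LO κ ≤ t κ := hlo κ
    simp only [hp]
    split_ifs
    · exact h1
    · exact le_rfl
  have hpHI : ∀ i, p i ≤ HI := by
    intro i κ
    have h1 : LO κ ≤ t κ := hlo κ
    have h2 : t κ ≤ HI κ := hhi κ
    simp only [hp]
    split_ifs
    · exact h2
    · exact h1.trans h2
  -- one leg: from `p i` along `⟨i, _⟩` by `(t_i − LO_i).toNat` steps one reaches `p (i+1)`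
  have hstep : ∀ (i : ℕ) (hi : i < P.d),
      Function.update (p i) ⟨i, hi⟩ (p i ⟨i, hi⟩ + ((t ⟨i, hi⟩ - LO ⟨i, hi⟩).toNat : ℕ)) = p (i + 1) := by
    intro i hi
    funext κ
    rcases eq_or_ne κ ⟨i, hi⟩ with h | h
    · rw [h, Function.update_self]
      have h0 : LO ⟨i, hi⟩ ≤ t ⟨i, hi⟩ := hlo ⟨i, hi⟩
      have e1 : p i ⟨i, hi⟩ = LO ⟨i, hi⟩ := by simp [hp]
      have e2 : p (i + 1) ⟨i, hi⟩ = t ⟨i, hi⟩ := by simp [hp]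
      rw [e1, e2, Int.toNat_of_nonneg (by omega)]
      ring
    · rw [Function.update_of_ne h]
      have hne : (κ : ℕ) ≠ i := fun e => h (Fin.ext e)
      by_cases hlt : (κ : ℕ) < i
      · have e1 : p i κ = t κ := by simp [hp, hlt]
        have e2 : p (i + 1) κ = t κ := by simp [hp, Nat.lt_succ_of_lt hlt]
        rw [e1, e2]
      · have hlt' : ¬ (κ : ℕ) < i + 1 := by omega
        have e1 : p i κ = LO κ := by simp [hp, hlt]
        have e2 : p (i + 1) κ = LO κ := by simp [hp, hlt']
        rw [e1, e2]
  -- induction over the number of processed coordinates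
  have main : ∀ i, i ≤ P.d → dist1 ((u (castSite LO : Site P 0))⁻¹ * u (castSite (p i))) ≤ ∑ κ : Fin P.d, (if (κ : ℕ) < i then g κ else 0) := by
    intro i
    induction i with
    | zero =>
      intro _
      rw [hp0, inv_mul_cancel, GaugeGroup.dist1_one]
      exact Finset.sum_nonneg fun κ _ => by simp
    | succ i ih =>
      intro hi1
      have hi : i < P.d := hi1
      have ih' := ih hi.le
      -- the leg from `p i` to `p (i+1)`
      have hend : Function.update (p i) ⟨i, hi⟩ (p i ⟨i, hi⟩ + ((t ⟨i, hi⟩ - LO ⟨i, hi⟩).toNat : ℕ)) ≤ HI := by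
        rw [hstep i hi]; exact hpHI (i + 1)
      have hendμ : p i ⟨i, hi⟩ + ((t ⟨i, hi⟩ - LO ⟨i, hi⟩).toNat : ℕ) ≤ HI ⟨i, hi⟩ := by
        have := hend ⟨i, hi⟩; rwa [Function.update_self] at this
      have hleg : dist1 ((u (castSite (p i) : Site P 0))⁻¹ * u (castSite (p (i + 1)))) ≤
          Φ ⟨i, hi⟩ (t ⟨i, hi⟩ - LO ⟨i, hi⟩).toNat + (((t ⟨i, hi⟩ - LO ⟨i, hi⟩).toNat : ℕ) : ℝ) * θ := by
        have e1 : (castSite (p (i + 1)) : Site P 0) = runSite (castSite (p i)) ⟨i, hi⟩ (t ⟨i, hi⟩ - LO ⟨i, hi⟩).toNat := by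
          rw [runSite_castSite, hstep i hi]
        rw [e1]
        refine dist1_inv_mul_runSite_le_of_runSum u U₁ _ ⟨i, hi⟩ _ (hrun (p i) ⟨i, hi⟩ _ (hpLO i) hend) fun s hs => hU₁ _ ?_ ?_
        · -- source of the `s`-th run bond
          have e2 : (runBond (castSite (p i) : Site P 0) ⟨i, hi⟩ s).src = castSite (Function.update (p i) ⟨i, hi⟩ (p i ⟨i, hi⟩ + (s : ℕ))) := by
            show runSite (castSite (p i)) ⟨i, hi⟩ s = _
            rw [runSite_castSite]
          rw [e2]
          obtain ⟨h1, h2⟩ := update_mem_Icc (hpLO i) (hpHI i) hendμ hs.le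
          exact ⟨_, ⟨h1, h2⟩, rfl⟩
        · -- target of the `s`-th run bond
          have e3 : (runBond (castSite (p i) : Site P 0) ⟨i, hi⟩ s).tgt = castSite (Function.update (p i) ⟨i, hi⟩ (p i ⟨i, hi⟩ + ((s + 1 : ℕ) : ℤ))) := by
            show (runSite (castSite (p i)) ⟨i, hi⟩ s).shift ⟨i, hi⟩ = _
            rw [← runSite_succ, runSite_castSite]
          rw [e3]
          obtain ⟨h1, h2⟩ := update_mem_Icc (hpLO i) (hpHI i) hendμ (Nat.succ_le_of_lt hs)
          exact ⟨_, ⟨h1, h2⟩, rfl⟩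
      -- split the partial sum
      have hsum : (∑ κ : Fin P.d, (if (κ : ℕ) < i + 1 then g κ else 0)) = (∑ κ : Fin P.d, (if (κ : ℕ) < i then g κ else 0)) + g ⟨i, hi⟩ := by
        have hsplit : ∀ κ : Fin P.d, (if (κ : ℕ) < i + 1 then g κ else 0) = (if (κ : ℕ) < i then g κ else 0) + (if κ = ⟨i, hi⟩ then g κ else 0) := by
          intro κ
          rcases eq_or_ne κ ⟨i, hi⟩ with h | h
          · rw [if_pos h, h]
            have h1 : ¬ (((⟨i, hi⟩ : Fin P.d) : ℕ) < i) := lt_irrefl i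
            have h2 : (((⟨i, hi⟩ : Fin P.d) : ℕ) < i + 1) := Nat.lt_succ_self i
            rw [if_pos h2, if_neg h1, zero_add]
          · have hne : (κ : ℕ) ≠ i := fun e => h (Fin.ext e)
            rw [if_neg h, add_zero]
            by_cases hlt : (κ : ℕ) < i
            · rw [if_pos hlt, if_pos (Nat.lt_succ_of_lt hlt)]
            · have hlt' : ¬ (κ : ℕ) < i + 1 := by omega
              rw [if_neg hlt, if_neg hlt']
        rw [Finset.sum_congr rfl fun κ _ => hsplit κ, Finset.sum_add_distrib, Finset.sum_ite_eq' Finset.univ (⟨i, hi⟩ : Fin P.d),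
          if_pos (Finset.mem_univ _)]
      have hgi : g ⟨i, hi⟩ = Φ ⟨i, hi⟩ (t ⟨i, hi⟩ - LO ⟨i, hi⟩).toNat + (((t ⟨i, hi⟩ - LO ⟨i, hi⟩).toNat : ℕ) : ℝ) * θ := by
        simp [hgdef]
      rw [hsum, hgi]
      exact (dist1_inv_mul_chain _ (u (castSite (p i) : Site P 0)) _).trans (add_le_add ih' hleg)
  have hfin := main P.d le_rfl
  rw [hpd] at hfin
  refine hfin.trans (le_of_eq (Finset.sum_congr rfl fun κ _ => ?_))
  simp [κ.isLt, hgdef]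

/-- ★★★ **THE VARIATION LETTER `hvarU` ON A FINE LABEL BOX** (PAIRS): with monotone per-run summands `Φ_κ` and `0 ≤ θ`, for every two sites `x, x′` of the box
`castSite '' [LO, HI]`: `dist1 (u(x)⁻¹·u(x′)) ≤ 2·Σ_κ (Φ_κ(D_κ) + D_κ·θ)`, `D_κ := (HI_κ − LO_κ).toNat` — through the corner (`dist1 (a⁻¹c) ≤ dist1 (a⁻¹b) + dist1 (b⁻¹c)`,
`dist1 (x⁻¹c) = dist1 (c⁻¹x)`) and §3 twice.  This is the `hvarU` of FILE 9's ∕ FILE 11's fine doors with `S :=` the fine box and `ς := 2·Σ_κ (Φ_κ(D_κ) + D_κ·θ)`.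
[cite: Balaban1985Variational, (144) p.300, (152) p.301; Balaban1984PropagatorsI, (1.7) p.18; Balaban1985Averaging, (8) p.19] -/
theorem fineVariation_le_of_runSums (u : GaugeTransf P 0 G) (U₁ : GaugeField P 0 G) {LO HI : Fin P.d → ℤ} (Φ : Fin P.d → ℕ → ℝ) {θ : ℝ} (hθ : 0 ≤ θ)
    (hΦ : ∀ κ, Monotone (Φ κ))
    (hrun : ∀ (z : Fin P.d → ℤ) (μ : Fin P.d) (m : ℕ), LO ≤ z → Function.update z μ (z μ + m) ≤ HI →
      ∑ s ∈ Finset.range m, dist1 (gaugeAct u U₁ (runBond (castSite z : Site P 0) μ s)) ≤ Φ μ m)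
    (hU₁ : ∀ b : PBond P 0, b.src ∈ (castSite '' Set.Icc LO HI : Set (Site P 0)) → b.tgt ∈ (castSite '' Set.Icc LO HI : Set (Site P 0)) → dist1 (U₁ b) ≤ θ) :
    ∀ x ∈ (castSite '' Set.Icc LO HI : Set (Site P 0)), ∀ x' ∈ (castSite '' Set.Icc LO HI : Set (Site P 0)),
      dist1 ((u x)⁻¹ * u x') ≤ 2 * ∑ κ, (Φ κ (HI κ - LO κ).toNat + ((HI κ - LO κ).toNat : ℝ) * θ) := by
  rintro _ ⟨t, ⟨htlo, hthi⟩, rfl⟩ _ ⟨t', ⟨ht'lo, ht'hi⟩, rfl⟩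
  -- each corner leg is bounded by the uniform letter
  have hunif : ∀ s : Fin P.d → ℤ, LO ≤ s → s ≤ HI →
      dist1 ((u (castSite LO : Site P 0))⁻¹ * u (castSite s)) ≤ ∑ κ, (Φ κ (HI κ - LO κ).toNat + ((HI κ - LO κ).toNat : ℝ) * θ) := by
    intro s hslo hshi
    refine (dist1_corner_le_of_runSums u U₁ Φ hrun hU₁ hslo hshi).trans (Finset.sum_le_sum fun κ _ => ?_)
    have h2 : s κ ≤ HI κ := hshi κ
    have hle : (s κ - LO κ).toNat ≤ (HI κ - LO κ).toNat := Int.toNat_le_toNat (by omega)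
    exact add_le_add (hΦ κ hle) (mul_le_mul_of_nonneg_right (by exact_mod_cast hle) hθ)
  -- through the corner
  have hsymm : dist1 ((u (castSite t : Site P 0))⁻¹ * u (castSite LO)) = dist1 ((u (castSite LO : Site P 0))⁻¹ * u (castSite t)) := by
    have e : (u (castSite t : Site P 0))⁻¹ * u (castSite LO) = ((u (castSite LO : Site P 0))⁻¹ * u (castSite t))⁻¹ := by group
    rw [e, GaugeGroup.dist1_inv]
  calc dist1 ((u (castSite t : Site P 0))⁻¹ * u (castSite t'))
      ≤ dist1 ((u (castSite t : Site P 0))⁻¹ * u (castSite LO)) + dist1 ((u (castSite LO : Site P 0))⁻¹ * u (castSite t')) := dist1_inv_mul_chain _ _ _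
    _ ≤ (∑ κ, (Φ κ (HI κ - LO κ).toNat + ((HI κ - LO κ).toNat : ℝ) * θ)) + ∑ κ, (Φ κ (HI κ - LO κ).toNat + ((HI κ - LO κ).toNat : ℝ) * θ) := by
        rw [hsymm]; exact add_le_add (hunif t htlo hthi) (hunif t' ht'lo ht'hi)
    _ = 2 * ∑ κ, (Φ κ (HI κ - LO κ).toNat + ((HI κ - LO κ).toNat : ℝ) * θ) := by ring

/-- A6: at the trivial gauge `u = 1` and `U₁ = 1` the hypotheses of §4 hold with `Φ = 0`, `θ = 0` (every run sum and every bond letter is `0`), and the conclusion reads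
`dist1 (1⁻¹·1) ≤ 0` — the hypothesis set is inhabited. [cite: Balaban1985Variational, (152) p.301 (bookkeeping)] -/
theorem fineVariation_le_of_runSums_one (LO HI : Fin P.d → ℤ) :
    ∀ x ∈ (castSite '' Set.Icc LO HI : Set (Site P 0)), ∀ x' ∈ (castSite '' Set.Icc LO HI : Set (Site P 0)),
      dist1 (((fun _ : Site P 0 => (1 : G)) x)⁻¹ * (fun _ : Site P 0 => (1 : G)) x') ≤
        2 * ∑ κ, ((fun (_ : Fin P.d) (_ : ℕ) => (0 : ℝ)) κ (HI κ - LO κ).toNat + ((HI κ - LO κ).toNat : ℝ) * (0 : ℝ)) := by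
  refine fineVariation_le_of_runSums (fun _ : Site P 0 => (1 : G)) (fun _ : PBond P 0 => (1 : G)) (fun _ _ => (0 : ℝ)) le_rfl (fun _ _ _ _ => le_rfl)
    (fun z μ m _ _ => ?_) (fun b _ _ => ?_)
  · refine le_of_eq (Finset.sum_eq_zero fun s _ => ?_)
    simp [GaugeField.gaugeAct, GaugeGroup.dist1_one]
  · simp [GaugeGroup.dist1_one]

end Staircase

end Summit.QuantumFields.YangMills.BalabanUVNodes.N07FineBoxShearVariation

end
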